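import Literature.Analysis.FluidPDE.DistributionalPressurePoisson
import Literature.Analysis.FluidPDE.NewtonTestPotential
import Literature.Analysis.FluidPDE.CKNEpsilonRegularity
import HarnessLib

/-!
# The pressure tested against truncated Newtonian potentials (towards (13.20)–(13.21))

Analysis/FluidPDE support file (all results proved) in the decomposition of the named fact
`Literature.Analysis.FluidPDE.LemarieRieusset2016.pressure_localIntegrability`
(`CKNMorreyLemmas.lean`; Lemarié-Rieusset 2016, (13.19)–(13.21), p. 461: under `(ℋ_CKN)` the
pressure is in `L^q_{t,x}(I × B)`, `q ≤ min(q₀, 5/3)`, when `I × B(x_B, 2r_B) ⊆ Ω`).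

In print the pressure is split as `ζ_B p = ϖ_B + p_B + q_B` through the Newtonian kernel
((13.20)). Here the kernel is the tree's truncated Newtonian kernel `Γ₀` at radii `(ρ/2, ρ)`
and it is moved onto the test function: for `θ ∈ C_c^∞(I × B(x_B, R))` the slicewise potential
`Θ = N[θ(t,·)] ∈ C_c^∞(I × B(x_B, R + ρ))` (`NewtonTestPotential`) is inserted in the pressure
equation `∫∫ (D²Θ(u,u) + p ΔΘ) = 0` (`DistributionalPressurePoisson`, (13.19)); since
`ΔₓΘ = θ - Λθ` (`laplacian_newtonNearPotential`, Green's representation at scale `ρ`),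

  `∫∫_Ω p θ = ∫∫_Ω p Λθ - ∫∫_Ω D²ₓΘ(u, u)`     (`integral_pressure_mul_test_eq`).

The second term is the Calderón–Zygmund part: by `|D²Θ(u,u)| ≤ |u|² ∑ᵢⱼ |∂ⱼ∂ᵢΘ|`, Hölder with
exponents `(5/3, 5/2)` and the `L^{5/2}` bound for the Hessian of `N` (Stein 1970, III §1.3
Prop. 3, the tree's named fact `stein1970_hessian_Lp_bound`, through
`hessian_newtonNearPotential_half`),

  `‖∫∫_Ω D²Θ(u,u)‖ ≤ 9 C ‖u‖²_{L^{10/3}(I × B(x_B, R+ρ))} ‖θ‖_{L^{5/2}}`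
  (`enorm_integral_hessian_le_of_stein`),

which is the statement "`ϖ_B ∈ L^{5/3}_{t,x}`" of (13.20) in dual form. The first term (the
harmonic part, "`p_B ∈ L^{q₀}_t L^∞_x`") and the duality argument concluding
`p ∈ L^q_{t,x}(I × B)` are in `CKNPressureDualityFar` / `CKNPressureLocalIntegrability`.

## References

* P. G. Lemarié-Rieusset, *The Navier–Stokes Problem in the 21st Century*, CRC Press (2016),
  (13.19)–(13.21) p. 461. [LemarieRieusset2016]
* E. M. Stein, *Singular integrals and differentiability properties of functions* (1970),
  Ch. III §1.3, Prop. 3. [Stein1971]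
-/

noncomputable section

open MeasureTheory Set Function Filter Topology TopologicalSpace Metric InnerProductSpace
open scoped ENNReal NNReal RealInnerProductSpace ContDiff Laplacian

namespace Literature.Analysis.FluidPDE

variable {Ω : Opens (ℝ × EuclideanSpace ℝ (Fin 3))} {ν : ℝ}
  {f u : ℝ → EuclideanSpace ℝ (Fin 3) → EuclideanSpace ℝ (Fin 3)}
  {p : ℝ → EuclideanSpace ℝ (Fin 3) → ℝ} {a b R ρ : ℝ} {xB : EuclideanSpace ℝ (Fin 3)}
  {θ : ℝ → EuclideanSpace ℝ (Fin 3) → ℝ}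

/-! ### Second slice derivatives of a space–time test field -/

/-- The coordinate second slice derivatives `(t, x) ↦ ∂_c∂_d ψ(t,·)(x)` of a space–time test
field are continuous (joint smoothness, the tree's `SpaceTimeCalculus`). [folklore] -/
theorem IsSpaceTimeTestOn.continuous_fderiv_fderiv_slice {Q : Opens (ℝ × EuclideanSpace ℝ (Fin 3))}
    {ψ : ℝ → EuclideanSpace ℝ (Fin 3) → ℝ} (hψ : IsSpaceTimeTestOn Q ψ)
    (c d : EuclideanSpace ℝ (Fin 3)) :
    Continuous fun z : ℝ × EuclideanSpace ℝ (Fin 3) =>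
      fderiv ℝ (fun y => fderiv ℝ (ψ z.1) y c) z.2 d := by
  have h := ((hψ.isSmoothSpaceTimeOn univ).isSmoothSpaceTimeOn_fderiv_apply isOpen_univ
    c).isSmoothSpaceTimeOn_fderiv_apply isOpen_univ d
  have hc := h.continuousOn
  rw [univ_prod_univ, continuousOn_univ] at hc
  exact hc

/-- The coordinate second slice derivatives of a space–time test field vanish off its
support. [folklore] -/
theorem fderiv_fderiv_slice_eq_zero_of_notMem_tsupport {ψ : ℝ → EuclideanSpace ℝ (Fin 3) → ℝ}
    {t : ℝ} {x : EuclideanSpace ℝ (Fin 3)} (h : (t, x) ∉ tsupport (uncurry ψ))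
    (c d : EuclideanSpace ℝ (Fin 3)) : fderiv ℝ (fun y => fderiv ℝ (ψ t) y c) x d = 0 := by
  have h0 : uncurry ψ =ᶠ[𝓝 (t, x)] 0 := notMem_tsupport_iff_eventuallyEq.1 h
  have hc : Continuous fun y : EuclideanSpace ℝ (Fin 3) => (t, y) :=
    continuous_const.prodMk continuous_id
  have h1 : ψ t =ᶠ[𝓝 x] fun _ => (0 : ℝ) := (hc.tendsto x).eventually h0
  have h2 : (fun y => fderiv ℝ (ψ t) y c) =ᶠ[𝓝 x] fun _ => (0 : ℝ) := by
    filter_upwards [eventually_eventuallyEq_nhds.2 h1] with y hy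
    rw [hy.fderiv_eq, fderiv_fun_const, Pi.zero_apply, _root_.zero_apply]
  rw [h2.fderiv_eq, fderiv_fun_const, Pi.zero_apply, _root_.zero_apply]

/-! ### The tested identity `∫∫ p θ = ∫∫ p Λθ - ∫∫ D²Θ(u, u)` -/

/-- Local notation-free abbreviations are avoided; the truncated potential of `θ` is written
`fun t => newtonNearPotential (ρ / 2) ρ (θ t)` throughout. The Hessian quadratic form of a
slice, in coordinates: `D²g(x)(v,v) = ∑ᵢⱼ ⟪v,eᵢ⟫⟪v,eⱼ⟫ ∂ⱼ∂ᵢg(x)` for `g ∈ C²`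
(`fderiv_fderiv_apply_eq_sum` with `fderiv_apply_const_apply`). [folklore] -/
theorem fderiv_fderiv_apply_apply_eq_sum {g : EuclideanSpace ℝ (Fin 3) → ℝ}
    (hg : ContDiff ℝ 2 g) (x v : EuclideanSpace ℝ (Fin 3)) :
    fderiv ℝ (fderiv ℝ g) x v v = ∑ i, ∑ j,
      (⟪v, EuclideanSpace.basisFun (Fin 3) ℝ i⟫ * ⟪v, EuclideanSpace.basisFun (Fin 3) ℝ j⟫) *
        fderiv ℝ (fun y => fderiv ℝ g y (EuclideanSpace.basisFun (Fin 3) ℝ i)) x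
          (EuclideanSpace.basisFun (Fin 3) ℝ j) := by
  have hD : DifferentiableAt ℝ (fderiv ℝ g) x :=
    ((hg.fderiv_right (m := 1) le_rfl).differentiable one_ne_zero) x
  rw [← fderiv_apply_const_apply hD v v,
    fderiv_fderiv_apply_eq_sum (EuclideanSpace.basisFun (Fin 3) ℝ) hg x v]

/-- **The pressure tested against a truncated Newtonian potential** (Lemarié-Rieusset 2016,
p. 461, the derivation of (13.20), with the truncated kernel on the test-function side). Let
`(u, p)` be a distributional Navier–Stokes solution on `Ω` with a force `f ∈ L¹_loc(Ω)`,
`div f = 0` (iterated form), let `I × B(x_B, R + ρ) ⊆ Ω` (`I = (a, b)`, `ρ > 0`), and let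
`θ ∈ C_c^∞(I × B(x_B, R))`. Then, with `Θ(t,·) = N_{ρ/2,ρ}[θ(t,·)]` and
`Λθ(t,·) = Λ_{ρ/2,ρ}[θ(t,·)]`,
`∫∫_Ω p θ = ∫∫_Ω p Λθ - ∫∫_Ω D²ₓΘ(u, u)`: the pressure equation (13.19) tested with
`Θ ∈ C_c^∞(Ω)`, and `ΔₓΘ = θ - Λθ`. [cite: LemarieRieusset2016, (13.19)–(13.20) p. 461] -/
theorem IsDistributionalNSSolutionOn.integral_pressure_mul_test_eq
    (hns : IsDistributionalNSSolutionOn Ω ν f u p)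
    (hfi : LocallyIntegrableOn (uncurry f) (Ω : Set (ℝ × EuclideanSpace ℝ (Fin 3))) volume)
    (hdivf : ∀ φ : ℝ → EuclideanSpace ℝ (Fin 3) → ℝ, IsSpaceTimeTestOn Ω φ →
      ∫ t, ∫ x, ⟪f t x, gradient (φ t) x⟫ = 0)
    (hρ : 0 < ρ)
    (hsub : Ioo a b ×ˢ ball xB (R + ρ) ⊆ (Ω : Set (ℝ × EuclideanSpace ℝ (Fin 3))))
    (hθ : IsSpaceTimeTestOn (⟨Ioo a b ×ˢ ball xB R, isOpen_Ioo.prod isOpen_ball⟩ :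
      Opens (ℝ × EuclideanSpace ℝ (Fin 3))) θ) :
    ∫ z in (Ω : Set (ℝ × EuclideanSpace ℝ (Fin 3))), p z.1 z.2 * θ z.1 z.2 =
      (∫ z in (Ω : Set (ℝ × EuclideanSpace ℝ (Fin 3))),
          p z.1 z.2 * newtonFarSmoothing (ρ / 2) ρ (θ z.1) z.2) -
        ∫ z in (Ω : Set (ℝ × EuclideanSpace ℝ (Fin 3))),
          fderiv ℝ (fderiv ℝ (newtonNearPotential (ρ / 2) ρ (θ z.1))) z.2 (u z.1 z.2)
            (u z.1 z.2) := by
  have h₀ : 0 < ρ / 2 := by positivity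
  have h₁ : ρ / 2 < ρ := by linarith
  set Θ : ℝ → EuclideanSpace ℝ (Fin 3) → ℝ := fun t => newtonNearPotential (ρ / 2) ρ (θ t)
    with hΘdef
  set Λθ : ℝ → EuclideanSpace ℝ (Fin 3) → ℝ := fun t => newtonFarSmoothing (ρ / 2) ρ (θ t)
    with hΛdef
  -- `Θ` is a test function on `Ω`
  have hΘ' := hθ.newtonNearPotential_slice h₀.le h₁
  have hΘ : IsSpaceTimeTestOn Ω Θ := ⟨hΘ'.contDiff, hΘ'.hasCompactSupport,
    hΘ'.tsupport_subset.trans hsub⟩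
  have hθ2 : ∀ t, ContDiff ℝ 2 (θ t) := fun t => contDiff_infty.1 (hθ.contDiff_slice t) 2
  -- the pressure equation tested with `Θ`
  have key := hns.integral_hessian_add_pressure_laplacian_eq_zero_of_iterated hfi hdivf hΘ
  have hΔ : ∀ z : ℝ × EuclideanSpace ℝ (Fin 3), Δ (Θ z.1) z.2 = θ z.1 z.2 - Λθ z.1 z.2 :=
    fun z => laplacian_newtonNearPotential h₀ h₁ (hθ2 z.1) z.2
  simp_rw [hΔ] at key
  -- integrability of the three pieces on `Ω`
  obtain ⟨hu, hu2, hp, -, -⟩ := hns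
  obtain ⟨hΛc, hΛsupp⟩ := tsupport_newtonFarSmoothing_slice_subset (ρ₀ := ρ / 2) hθ h₀.le h₁
  have hΛcont : Continuous (uncurry Λθ) :=
    (contDiff_uncurry_newtonFarSmoothing_slice hθ h₀ h₁).continuous
  have I1 : Integrable (fun z : ℝ × EuclideanSpace ℝ (Fin 3) => p z.1 z.2 * θ z.1 z.2)
      ((volume : Measure (ℝ × EuclideanSpace ℝ (Fin 3))).restrict Ω) :=
    (integrable_mul_of_locallyIntegrableOn hp hθ.contDiff.continuous hθ.hasCompactSupport
      (hθ.tsupport_subset.trans (Subset.trans (prod_mono Subset.rfl (ball_subset_ball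
        (by linarith))) hsub)) (fun z hz => image_eq_zero_of_notMem_tsupport hz)).integrableOn
  have I2 : Integrable (fun z : ℝ × EuclideanSpace ℝ (Fin 3) => p z.1 z.2 * Λθ z.1 z.2)
      ((volume : Measure (ℝ × EuclideanSpace ℝ (Fin 3))).restrict Ω) :=
    (integrable_mul_of_locallyIntegrableOn hp hΛcont hΛc (hΛsupp.trans hsub)
      (fun z hz => image_eq_zero_of_notMem_tsupport hz)).integrableOn
  -- the Hessian term is integrable: `|D²Θ(u,u)| ≤ C |u|²` on the support of `Θ`
  set e := EuclideanSpace.basisFun (Fin 3) ℝ with he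
  set H : Fin 3 → Fin 3 → ℝ × EuclideanSpace ℝ (Fin 3) → ℝ := fun i j z =>
    fderiv ℝ (fun y => fderiv ℝ (Θ z.1) y (e i)) z.2 (e j) with hH
  have hHc : ∀ i j, Continuous (H i j) := fun i j => hΘ.continuous_fderiv_fderiv_slice _ _
  have hH0 : ∀ i j z, z ∉ tsupport (uncurry Θ) → H i j z = 0 := fun i j z hz =>
    fderiv_fderiv_slice_eq_zero_of_notMem_tsupport (ψ := Θ) (t := z.1) (x := z.2) hz _ _
  have hHess : ∀ z : ℝ × EuclideanSpace ℝ (Fin 3),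
      fderiv ℝ (fderiv ℝ (Θ z.1)) z.2 (u z.1 z.2) (u z.1 z.2) =
        ∑ i, ∑ j, (⟪u z.1 z.2, e i⟫ * ⟪u z.1 z.2, e j⟫) * H i j z := fun z =>
    fderiv_fderiv_apply_apply_eq_sum (contDiff_infty.1 (hΘ.contDiff_slice z.1) 2) _ _
  have I3 : Integrable (fun z : ℝ × EuclideanSpace ℝ (Fin 3) =>
      fderiv ℝ (fderiv ℝ (Θ z.1)) z.2 (u z.1 z.2) (u z.1 z.2))
      ((volume : Measure (ℝ × EuclideanSpace ℝ (Fin 3))).restrict Ω) := by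
    simp_rw [hHess]
    refine integrable_finsetSum _ fun i _ => integrable_finsetSum _ fun j _ => ?_
    -- `⟪u,eᵢ⟫⟪u,eⱼ⟫ Hᵢⱼ` is dominated by `‖u‖² |Hᵢⱼ|`, `|Hᵢⱼ| ≤ C 𝟙_K`
    obtain ⟨C, hC⟩ := (hHc i j).bounded_above_of_compact_support
      (HasCompactSupport.intro hΘ.hasCompactSupport (hH0 i j))
    have hK := hu2.integrableOn_compact_subset hΘ.tsupport_subset hΘ.hasCompactSupport
    have hmeas : AEStronglyMeasurable (fun z : ℝ × EuclideanSpace ℝ (Fin 3) =>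
        (⟪u z.1 z.2, e i⟫ * ⟪u z.1 z.2, e j⟫) * H i j z)
        ((volume : Measure (ℝ × EuclideanSpace ℝ (Fin 3))).restrict Ω) := by
      have hum : AEStronglyMeasurable (uncurry u)
          ((volume : Measure (ℝ × EuclideanSpace ℝ (Fin 3))).restrict Ω) :=
        hu.aestronglyMeasurable
      exact ((hum.inner aestronglyMeasurable_const).mul (hum.inner aestronglyMeasurable_const)).mul
        (hHc i j).aestronglyMeasurable
    refine Integrable.mono' (g := fun z => C * (tsupport (uncurry Θ)).indicator
      (fun z => ‖uncurry u z‖ ^ 2) z) ?_ hmeas (Eventually.of_forall fun z => ?_)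
    · exact (((integrable_indicator_iff (isClosed_tsupport _).measurableSet).2 hK).const_mul
        C).mono_measure Measure.restrict_le_self
    · by_cases hz : z ∈ tsupport (uncurry Θ)
      · rw [indicator_of_mem hz, norm_mul, norm_mul]
        have h1 : ‖⟪u z.1 z.2, e i⟫‖ ≤ ‖u z.1 z.2‖ := by
          refine (norm_inner_le_norm _ _).trans ?_
          rw [e.orthonormal.1 i, mul_one]
        have h2 : ‖⟪u z.1 z.2, e j⟫‖ ≤ ‖u z.1 z.2‖ := by
          refine (norm_inner_le_norm _ _).trans ?_
          rw [e.orthonormal.1 j, mul_one]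
        calc ‖⟪u z.1 z.2, e i⟫‖ * ‖⟪u z.1 z.2, e j⟫‖ * ‖H i j z‖
            ≤ ‖u z.1 z.2‖ * ‖u z.1 z.2‖ * C :=
              mul_le_mul (mul_le_mul h1 h2 (norm_nonneg _) (norm_nonneg _)) (hC z)
                (norm_nonneg _) (mul_nonneg (norm_nonneg _) (norm_nonneg _))
          _ = C * ‖uncurry u z‖ ^ 2 := by
              rw [show uncurry u z = u z.1 z.2 from rfl]; ring
      · rw [hH0 i j z hz, mul_zero, norm_zero, indicator_of_notMem hz, mul_zero]
  -- split the tested equation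
  have hsplit : ∀ z : ℝ × EuclideanSpace ℝ (Fin 3),
      fderiv ℝ (fderiv ℝ (Θ z.1)) z.2 (u z.1 z.2) (u z.1 z.2) +
          p z.1 z.2 * (θ z.1 z.2 - Λθ z.1 z.2) =
        fderiv ℝ (fderiv ℝ (Θ z.1)) z.2 (u z.1 z.2) (u z.1 z.2) +
          p z.1 z.2 * θ z.1 z.2 - p z.1 z.2 * Λθ z.1 z.2 := fun z => by ring
  simp_rw [hsplit] at key
  have I31 : Integrable (fun z : ℝ × EuclideanSpace ℝ (Fin 3) =>
      fderiv ℝ (fderiv ℝ (Θ z.1)) z.2 (u z.1 z.2) (u z.1 z.2) + p z.1 z.2 * θ z.1 z.2)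
      ((volume : Measure (ℝ × EuclideanSpace ℝ (Fin 3))).restrict Ω) := I3.add I1
  rw [integral_sub I31 I2, integral_add I3 I1] at key
  linarith

/-! ### The Calderón–Zygmund term: `‖∫∫ D²Θ(u,u)‖ ≤ 9 C ‖u‖²_{L^{10/3}} ‖θ‖_{L^{5/2}}` -/

/-- `∫⁻ ‖g‖ₑ^{5/2} = ‖g‖_{L^{5/2}}^{5/2}` for the exponent `5/2` written as `ENNReal.ofReal (5/2)`.
[folklore] -/
theorem lintegral_rpow_enorm_five_halves {α : Type*} [MeasurableSpace α] (μ : Measure α)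
    (g : α → ℝ) :
    ∫⁻ x, ‖g x‖ₑ ^ (5 / 2 : ℝ) ∂μ = eLpNorm g (ENNReal.ofReal (5 / 2)) μ ^ (5 / 2 : ℝ) := by
  rw [eLpNorm_eq_eLpNorm' (by simp) ENNReal.ofReal_ne_top, ENNReal.toReal_ofReal (by norm_num)]
  exact lintegral_rpow_enorm_eq_rpow_eLpNorm' (by norm_num)

/-- **The Calderón–Zygmund part of the pressure, dual form** (Lemarié-Rieusset 2016, p. 461:
"`ϖ_B = ∑ ∂ⱼ∂ₗG * (ζ_B uⱼuₗ) ∈ L^{5/3}_{t,x}(I × B)`" by Calderón–Zygmund and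
`u ∈ L^{10/3}_{t,x}`). Let `C` be a constant as produced by Stein's Proposition 3 for the
truncated Newtonian potentials at exponent `5/2`
(`stein1970_hessian_Lp_bound.hessian_newtonNearPotential_half`:
`‖∂ₐ∂_b N_{r/2,r}[g]‖_{L^{5/2}} ≤ C ‖g‖_{L^{5/2}}`). For `θ ∈ C_c^∞(I × B(x_B, R))`, `ρ > 0`,
`Θ(t,·) = N_{ρ/2,ρ}[θ(t,·)]`, a field `u` measurable on `I × B(x_B, R + ρ)` and any set `Ω'`:
`‖∫∫_{Ω'} D²ₓΘ(u,u)‖ ≤ 9 C (∫∫_{I×B(x_B,R+ρ)} |u|^{10/3})^{3/5} (∫∫_{I×B(x_B,R)} |θ|^{5/2})^{2/5}`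
(`|D²Θ(u,u)| ≤ |u|² ∑ᵢⱼ |∂ⱼ∂ᵢΘ|`, Hölder with exponents `5/3, 5/2`, the `L^{5/2}` bound
slice-wise in `t`, and Tonelli). [cite: LemarieRieusset2016, (13.20) p. 461] -/
theorem enorm_integral_hessian_newtonNearPotential_le {C : ℝ≥0}
    (hC : ∀ ⦃r : ℝ⦄, 0 < r → ∀ ⦃g : EuclideanSpace ℝ (Fin 3) → ℝ⦄, ContDiff ℝ 2 g →
      HasCompactSupport g → ∀ a b : EuclideanSpace ℝ (Fin 3), ‖a‖ ≤ 1 → ‖b‖ ≤ 1 →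
        eLpNorm (fun x => fderiv ℝ (fun y => fderiv ℝ (newtonNearPotential (r / 2) r g) y a) x b)
            (ENNReal.ofReal (5 / 2)) volume ≤ C * eLpNorm g (ENNReal.ofReal (5 / 2)) volume)
    (hρ : 0 < ρ)
    (hθ : IsSpaceTimeTestOn (⟨Ioo a b ×ˢ ball xB R, isOpen_Ioo.prod isOpen_ball⟩ :
      Opens (ℝ × EuclideanSpace ℝ (Fin 3))) θ)
    (hum : AEStronglyMeasurable (uncurry u) ((volume : Measure (ℝ × EuclideanSpace ℝ (Fin 3))
      ).restrict (Ioo a b ×ˢ ball xB (R + ρ))))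
    (Ω' : Set (ℝ × EuclideanSpace ℝ (Fin 3))) :
    ‖∫ z in Ω', fderiv ℝ (fderiv ℝ (newtonNearPotential (ρ / 2) ρ (θ z.1))) z.2 (u z.1 z.2)
        (u z.1 z.2)‖ₑ ≤
      9 * C * (∫⁻ z in Ioo a b ×ˢ ball xB (R + ρ), ‖u z.1 z.2‖ₑ ^ (10 / 3 : ℝ)) ^ (3 / 5 : ℝ) *
        (∫⁻ z in Ioo a b ×ˢ ball xB R, ‖θ z.1 z.2‖ₑ ^ (5 / 2 : ℝ)) ^ (2 / 5 : ℝ) := by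
  have h₀ : 0 < ρ / 2 := by positivity
  have h₁ : ρ / 2 < ρ := by linarith
  set S : Set (ℝ × EuclideanSpace ℝ (Fin 3)) := Ioo a b ×ˢ ball xB R with hS
  set S' : Set (ℝ × EuclideanSpace ℝ (Fin 3)) := Ioo a b ×ˢ ball xB (R + ρ) with hS'
  set μ : Measure (ℝ × EuclideanSpace ℝ (Fin 3)) := volume.restrict S' with hμ
  set Θ : ℝ → EuclideanSpace ℝ (Fin 3) → ℝ := fun t => newtonNearPotential (ρ / 2) ρ (θ t)
    with hΘdef
  have hΘ := hθ.newtonNearPotential_slice h₀.le h₁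
  have hθ2 : ∀ t, ContDiff ℝ 2 (θ t) := fun t => contDiff_infty.1 (hθ.contDiff_slice t) 2
  have hθc : ∀ t, HasCompactSupport (θ t) := fun t => hθ.hasCompactSupport_slice t
  -- coordinates
  set e := EuclideanSpace.basisFun (Fin 3) ℝ with he
  set H : Fin 3 → Fin 3 → ℝ × EuclideanSpace ℝ (Fin 3) → ℝ := fun i j z =>
    fderiv ℝ (fun y => fderiv ℝ (Θ z.1) y (e i)) z.2 (e j) with hH
  have hHc : ∀ i j, Continuous (H i j) := fun i j => hΘ.continuous_fderiv_fderiv_slice _ _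
  have hH0 : ∀ i j z, z ∉ tsupport (uncurry Θ) → H i j z = 0 := fun i j z hz =>
    fderiv_fderiv_slice_eq_zero_of_notMem_tsupport (ψ := Θ) (t := z.1) (x := z.2) hz _ _
  set F : ℝ × EuclideanSpace ℝ (Fin 3) → ℝ := fun z =>
    fderiv ℝ (fderiv ℝ (Θ z.1)) z.2 (u z.1 z.2) (u z.1 z.2) with hF
  have hHess : ∀ z, F z = ∑ i, ∑ j, (⟪u z.1 z.2, e i⟫ * ⟪u z.1 z.2, e j⟫) * H i j z := fun z =>
    fderiv_fderiv_apply_apply_eq_sum (contDiff_infty.1 (hΘ.contDiff_slice z.1) 2) _ _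
  -- pointwise: `‖F‖ₑ ≤ ∑ᵢⱼ ‖u‖ₑ² ‖Hᵢⱼ‖ₑ`, and `F` vanishes off `tsupport Θ ⊆ S'`
  have hFle : ∀ z, ‖F z‖ₑ ≤ ∑ i, ∑ j, ‖u z.1 z.2‖ₑ ^ 2 * ‖H i j z‖ₑ := fun z => by
    rw [hHess z]
    refine (enorm_sum_le _ _).trans (Finset.sum_le_sum fun i _ => ?_)
    refine (enorm_sum_le _ _).trans (Finset.sum_le_sum fun j _ => ?_)
    rw [enorm_mul, enorm_mul]
    gcongr
    have h1 : ‖⟪u z.1 z.2, e i⟫‖ₑ ≤ ‖u z.1 z.2‖ₑ := by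
      rw [← ofReal_norm, ← ofReal_norm]
      refine ENNReal.ofReal_le_ofReal ((norm_inner_le_norm _ _).trans ?_)
      rw [e.orthonormal.1 i, mul_one]
    have h2 : ‖⟪u z.1 z.2, e j⟫‖ₑ ≤ ‖u z.1 z.2‖ₑ := by
      rw [← ofReal_norm, ← ofReal_norm]
      refine ENNReal.ofReal_le_ofReal ((norm_inner_le_norm _ _).trans ?_)
      rw [e.orthonormal.1 j, mul_one]
    calc ‖⟪u z.1 z.2, e i⟫‖ₑ * ‖⟪u z.1 z.2, e j⟫‖ₑ ≤ ‖u z.1 z.2‖ₑ * ‖u z.1 z.2‖ₑ :=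
          mul_le_mul' h1 h2
      _ = ‖u z.1 z.2‖ₑ ^ 2 := (sq _).symm
  have hF0 : support (fun z => ‖F z‖ₑ) ⊆ S' := by
    intro z hz
    by_contra hzS
    have hz' : z ∉ tsupport (uncurry Θ) := fun h => hzS (hΘ.tsupport_subset h)
    refine hz ?_
    simp only [hHess z, hH0 _ _ z hz', mul_zero, Finset.sum_const_zero, enorm_zero]
  -- measurability
  have hum' : AEMeasurable (fun z : ℝ × EuclideanSpace ℝ (Fin 3) => ‖u z.1 z.2‖ₑ ^ 2) μ :=
    (hum.enorm.pow_const 2)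
  have hHm : ∀ i j, AEMeasurable (fun z => ‖H i j z‖ₑ) μ := fun i j =>
    (hHc i j).measurable.enorm.aemeasurable
  -- Step 1: `‖∫_{Ω'} F‖ ≤ ∫⁻_{S'} ‖F‖ ≤ ∑ᵢⱼ ∫⁻_{S'} ‖u‖² ‖Hᵢⱼ‖`
  have step1 : ‖∫ z in Ω', F z‖ₑ ≤ ∑ i, ∑ j, ∫⁻ z, ‖u z.1 z.2‖ₑ ^ 2 * ‖H i j z‖ₑ ∂μ := by
    calc ‖∫ z in Ω', F z‖ₑ ≤ ∫⁻ z in Ω', ‖F z‖ₑ := enorm_integral_le_lintegral_enorm _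
      _ ≤ ∫⁻ z, ‖F z‖ₑ := lintegral_mono' Measure.restrict_le_self le_rfl
      _ = ∫⁻ z in S', ‖F z‖ₑ := (setLIntegral_eq_of_support_subset hF0).symm
      _ ≤ ∫⁻ z in S', ∑ i, ∑ j, ‖u z.1 z.2‖ₑ ^ 2 * ‖H i j z‖ₑ := lintegral_mono hFle
      _ = ∑ i, ∑ j, ∫⁻ z, ‖u z.1 z.2‖ₑ ^ 2 * ‖H i j z‖ₑ ∂μ := by
          have hg : ∀ i j, AEMeasurable (fun z => ‖u z.1 z.2‖ₑ ^ 2 * ‖H i j z‖ₑ) μ :=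
            fun i j => hum'.mul (hHm i j)
          have hgi : ∀ i, AEMeasurable (fun z => ∑ j, ‖u z.1 z.2‖ₑ ^ 2 * ‖H i j z‖ₑ) μ :=
            fun i => Finset.aemeasurable_fun_sum _ fun j _ => hg i j
          rw [hμ, lintegral_finsetSum' _ fun i _ => hgi i]
          exact Finset.sum_congr rfl fun i _ => lintegral_finsetSum' _ fun j _ => hg i j
  -- Step 2: Hölder with exponents `5/3`, `5/2`
  have hpq : Real.HolderConjugate (5 / 3) (5 / 2) :=
    Real.holderConjugate_iff.2 ⟨by norm_num, by norm_num⟩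
  set U : ℝ≥0∞ := ∫⁻ z in S', ‖u z.1 z.2‖ₑ ^ (10 / 3 : ℝ) with hU
  have step2 : ∀ i j, ∫⁻ z, ‖u z.1 z.2‖ₑ ^ 2 * ‖H i j z‖ₑ ∂μ ≤
      U ^ (3 / 5 : ℝ) * (∫⁻ z, ‖H i j z‖ₑ ^ (5 / 2 : ℝ) ∂μ) ^ (2 / 5 : ℝ) := fun i j => by
    have h := ENNReal.lintegral_mul_le_Lp_mul_Lq μ hpq hum' (hHm i j)
    have e1 : ∀ z : ℝ × EuclideanSpace ℝ (Fin 3),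
        (‖u z.1 z.2‖ₑ ^ 2) ^ (5 / 3 : ℝ) = ‖u z.1 z.2‖ₑ ^ (10 / 3 : ℝ) := fun z => by
      rw [show (‖u z.1 z.2‖ₑ ^ 2 : ℝ≥0∞) = ‖u z.1 z.2‖ₑ ^ (2 : ℝ) by
        rw [show (2 : ℝ) = ((2 : ℕ) : ℝ) by norm_num, ENNReal.rpow_natCast], ← ENNReal.rpow_mul]
      norm_num
    simp only [Pi.mul_apply, e1] at h
    rw [show (1 : ℝ) / (5 / 3) = 3 / 5 by norm_num, show (1 : ℝ) / (5 / 2) = 2 / 5 by norm_num]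
      at h
    exact h
  -- Step 3: the `L^{5/2}` bound slice-wise and Tonelli
  set T : ℝ≥0∞ := ∫⁻ z in S, ‖θ z.1 z.2‖ₑ ^ (5 / 2 : ℝ) with hT
  have hTeq : ∫⁻ t, ∫⁻ x, ‖θ t x‖ₑ ^ (5 / 2 : ℝ) = T := by
    have hmeas : AEMeasurable (fun z : ℝ × EuclideanSpace ℝ (Fin 3) => ‖θ z.1 z.2‖ₑ ^ (5 / 2 : ℝ))
        ((volume : Measure ℝ).prod (volume : Measure (EuclideanSpace ℝ (Fin 3)))) := by
      rw [← Measure.volume_eq_prod]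
      exact (hθ.contDiff.continuous.measurable.enorm.pow_const _).aemeasurable
    have hsupp :
        support (fun z : ℝ × EuclideanSpace ℝ (Fin 3) => ‖θ z.1 z.2‖ₑ ^ (5 / 2 : ℝ)) ⊆ S := by
      intro z hz
      by_contra hzS
      have h0 : θ z.1 z.2 = 0 := hθ.apply_eq_zero hzS
      exact hz (by simp [h0, ENNReal.zero_rpow_of_pos (by norm_num : (0 : ℝ) < 5 / 2)])
    rw [← lintegral_prod _ hmeas, ← Measure.volume_eq_prod, hT,
      setLIntegral_eq_of_support_subset hsupp]
  have step3 : ∀ i j, ∫⁻ z, ‖H i j z‖ₑ ^ (5 / 2 : ℝ) ∂μ ≤ (C : ℝ≥0∞) ^ (5 / 2 : ℝ) * T :=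
    fun i j => by
    have hei : ‖e i‖ ≤ 1 := (e.orthonormal.1 i).le
    have hej : ‖e j‖ ≤ 1 := (e.orthonormal.1 j).le
    -- slice-wise bound
    have hslice : ∀ t, ∫⁻ x, ‖H i j (t, x)‖ₑ ^ (5 / 2 : ℝ) ≤
        (C : ℝ≥0∞) ^ (5 / 2 : ℝ) * ∫⁻ x, ‖θ t x‖ₑ ^ (5 / 2 : ℝ) := fun t => by
      have hst := hC hρ (hθ2 t) (hθc t) (e i) (e j) hei hej
      have h1 := lintegral_rpow_enorm_five_halves (volume : Measure (EuclideanSpace ℝ (Fin 3)))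
        (fun x => fderiv ℝ (fun y => fderiv ℝ (newtonNearPotential (ρ / 2) ρ (θ t)) y (e i)) x
          (e j))
      have h2 := lintegral_rpow_enorm_five_halves (volume : Measure (EuclideanSpace ℝ (Fin 3)))
        (θ t)
      change ∫⁻ x, ‖fderiv ℝ (fun y => fderiv ℝ (newtonNearPotential (ρ / 2) ρ (θ t)) y (e i)) x
        (e j)‖ₑ ^ (5 / 2 : ℝ) ≤ (C : ℝ≥0∞) ^ (5 / 2 : ℝ) * ∫⁻ x, ‖θ t x‖ₑ ^ (5 / 2 : ℝ)
      rw [h1, h2, ← ENNReal.mul_rpow_of_nonneg _ _ (by norm_num)]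
      exact ENNReal.rpow_le_rpow hst (by norm_num)
    calc ∫⁻ z, ‖H i j z‖ₑ ^ (5 / 2 : ℝ) ∂μ ≤ ∫⁻ z, ‖H i j z‖ₑ ^ (5 / 2 : ℝ) :=
          lintegral_mono' Measure.restrict_le_self le_rfl
      _ ≤ ∫⁻ t, ∫⁻ x, ‖H i j (t, x)‖ₑ ^ (5 / 2 : ℝ) := by
          rw [Measure.volume_eq_prod]; exact lintegral_prod_le _
      _ ≤ ∫⁻ t, (C : ℝ≥0∞) ^ (5 / 2 : ℝ) * ∫⁻ x, ‖θ t x‖ₑ ^ (5 / 2 : ℝ) := lintegral_mono hslice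
      _ = (C : ℝ≥0∞) ^ (5 / 2 : ℝ) * T := by
          rw [lintegral_const_mul' _ _ (ENNReal.rpow_ne_top_of_nonneg (by norm_num)
            ENNReal.coe_ne_top), hTeq]
  -- Step 4: assemble
  have step4 : ∀ i j, ∫⁻ z, ‖u z.1 z.2‖ₑ ^ 2 * ‖H i j z‖ₑ ∂μ ≤
      C * U ^ (3 / 5 : ℝ) * T ^ (2 / 5 : ℝ) := fun i j => by
    refine (step2 i j).trans ?_
    have h := ENNReal.rpow_le_rpow (step3 i j) (by norm_num : (0 : ℝ) ≤ 2 / 5)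
    rw [ENNReal.mul_rpow_of_nonneg _ _ (by norm_num), ← ENNReal.rpow_mul,
      show (5 / 2 : ℝ) * (2 / 5) = 1 by norm_num, ENNReal.rpow_one] at h
    calc U ^ (3 / 5 : ℝ) * (∫⁻ z, ‖H i j z‖ₑ ^ (5 / 2 : ℝ) ∂μ) ^ (2 / 5 : ℝ)
        ≤ U ^ (3 / 5 : ℝ) * (C * T ^ (2 / 5 : ℝ)) := mul_le_mul' le_rfl h
      _ = C * U ^ (3 / 5 : ℝ) * T ^ (2 / 5 : ℝ) := by ring
  calc ‖∫ z in Ω', F z‖ₑ ≤ ∑ i, ∑ j, ∫⁻ z, ‖u z.1 z.2‖ₑ ^ 2 * ‖H i j z‖ₑ ∂μ := step1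
    _ ≤ ∑ _i : Fin 3, ∑ _j : Fin 3, C * U ^ (3 / 5 : ℝ) * T ^ (2 / 5 : ℝ) :=
        Finset.sum_le_sum fun i _ => Finset.sum_le_sum fun j _ => step4 i j
    _ = 9 * C * U ^ (3 / 5 : ℝ) * T ^ (2 / 5 : ℝ) := by
        simp only [Finset.sum_const, Finset.card_univ, Fintype.card_fin, nsmul_eq_mul,
          Nat.cast_ofNat]
        ring


end Literature.Analysis.FluidPDE
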